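import Mathlib
import HarnessLib
import Literature.Analysis.FluidPDE.ParasiticSlabFlow
import Summits.NavierStokesRegularity.NavierStokesRegularity.Theorems.PoloidalWindowRigidity.Negative.CellField

/-!
# Crux K2 `PoloidalWindowRigidity` (stmt-NavierStokesRegularity-19708), skeleton lrc-jet v4 — negative side, brick 1/2:
# the STUART COLUMN, a frozen poloidal Type-I profile whose shear slope varies ACROSS the vortex lines

Negative-side support (refuter seat ns-regularity-refuter1, cell ns-regularity-ideate; D-0081 §C): explicit vector
calculus for the kinematic witness used in `…Negative.LrcGenericFalseWithoutMild` against the research stub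
`stub_lrcGeneric` (LRC″ on the THICK stratum) of skeleton `Cruxes/PoloidalWindowRigidity/Lines/lrc_jet.lean` (v4).

The field. With the Kelvin–Stuart cat's-eye weight `W(x) = e^{x₀} + e^{−x₀} + cos x₁ = 2 cosh x₀ + cos x₁ ≥ 1`
(the planar stream function `log W` solves the Liouville equation `Δ log W = 3/W²`, i.e. `W ΔW − |∇W|² = 3`),
`V(x) = (cos x₂ · (e^{x₀} − e^{−x₀})/W, −cos x₂ · sin x₁/W, −3 sin x₂/W²) = (cos x₂ ∇ₕ log W, −3 sin x₂ W⁻²)`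
and the Type-I profile `v(t, x) = (−t)^{-1/2} V(x)` (`stuartProfile`). Certified here:
* `hasFDerivAt_stuartField` / `fderiv_stuartField_apply`: the derivative in closed form; `‖V‖ ≤ 6`;
* `curl_stuartProfile`: `curl v(t)(x) = −(−t)^{-1/2} sin x₂ (W⁻¹ + 6 W⁻³) (sin x₁, e^{x₀} − e^{−x₀}, 0)` — horizontal,
  so (P) poloidal along `e₂`; (D) `div v = 0` (this IS the Liouville identity); (R) Type-I rate `6`; (C) continuity;
* `frozen_stuartProfile`: `⟪Dv · curl v, e₂⟫ = 0` — `v₂` is a first integral of the vortex lines (the structure that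
  (P) + the Oseen-mild identity force in the class, via the vertical vorticity equation);
* `thickShear_stuartProfile`: proportional shear `6 ∂₂ v_b = −W² ∂_b v₂` (`b = 0, 1`): the Clebsch slope
  `Λ = −W(x₀,x₁)²/6` is constant along each vortex line (a level set of `W` in a horizontal plane) and VARIES ACROSS
  them — the field lies in the thick stratum of the K2 lead's census, where every earlier witness of this lane had
  `Λ = Λ(t)` or `Λ = Λ(x₂)` (separable frozen fields built from finitely many Laplace eigenmodes cannot be thick: two
  eigenmodes are functionally dependent only in the isoparametric, hence symmetric, case; the cat's eye replaces the
  Helmholtz equation by the semilinear Liouville equation).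

WHAT THIS IS NOT: not a claim about Navier–Stokes regularity — explicit vector calculus for a kinematic witness
(`V` is not a Navier–Stokes flow).
-/

noncomputable section

-- the summit and its single sub-problem share the name (CONVENTIONS §1), as in every Theorems file
set_option linter.dupNamespace false

namespace Summit.NavierStokesRegularity.NavierStokesRegularity.Theorems.PoloidalWindowRigidity.Negative

open MeasureTheory Set Function Filter Topology Metric
open scoped RealInnerProductSpace InnerProductSpace
open Literature.Analysis Literature.Analysis.FluidPDE

local notation "E3" => EuclideanSpace ℝ (Fin 3)
local notation "π" i => (EuclideanSpace.proj (𝕜 := ℝ) (i : Fin 3) : EuclideanSpace ℝ (Fin 3) →L[ℝ] ℝ)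
local notation "𝐞" i => (EuclideanSpace.single (i : Fin 3) (1 : ℝ) : EuclideanSpace ℝ (Fin 3))

/-! ## The cat's-eye weight -/

/-- The Kelvin–Stuart cat's-eye weight `W(x) = e^{x₀} + e^{−x₀} + cos x₁` (`= 2 cosh x₀ + cos x₁`). [folklore] -/
def stuartW (x : E3) : ℝ := Real.exp (x 0) + Real.exp (-(x 0)) + Real.cos (x 1)

/-- `W ≥ 1`. [folklore] -/
theorem one_le_stuartW (x : E3) : 1 ≤ stuartW x := by
  have h1 : Real.exp (x 0) + Real.exp (-(x 0)) = 2 * Real.cosh (x 0) := by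
    rw [Real.cosh_eq]; ring
  have h2 := Real.one_le_cosh (x 0)
  have h3 := Real.neg_one_le_cos (x 1)
  unfold stuartW
  linarith

/-- `W > 0`. [folklore] -/
theorem stuartW_pos (x : E3) : 0 < stuartW x := lt_of_lt_of_le one_pos (one_le_stuartW x)

/-- `W ≠ 0`. [folklore] -/
theorem stuartW_ne_zero (x : E3) : stuartW x ≠ 0 := (stuartW_pos x).ne'

/-- `e^{x₀} e^{−x₀} = 1`. [folklore] -/
theorem exp_mul_exp_neg (a : ℝ) : Real.exp a * Real.exp (-a) = 1 := by
  rw [← Real.exp_add, add_neg_cancel, Real.exp_zero]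

/-- `DW(x) = e^{x₀} dx₀ − e^{−x₀} dx₀ − sin x₁ dx₁` (in the shape produced by the chain rule). [folklore] -/
theorem hasFDerivAt_stuartW (x : E3) :
    HasFDerivAt stuartW
      (Real.exp (x 0) • (π 0) + Real.exp (-(x 0)) • (-(π 0)) + (-(Real.sin (x 1))) • (π 1)) x := by
  have h0 : HasFDerivAt (fun y : E3 => y 0) (π 0) x := (π 0).hasFDerivAt
  have h1 : HasFDerivAt (fun y : E3 => y 1) (π 1) x := (π 1).hasFDerivAt
  have hE := (Real.hasDerivAt_exp (x 0)).comp_hasFDerivAt x h0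
  have hE' := (Real.hasDerivAt_exp (-(x 0))).comp_hasFDerivAt x h0.neg
  have hc1 := (Real.hasDerivAt_cos (x 1)).comp_hasFDerivAt x h1
  exact (hE.add hE').add hc1

/-- `W` is differentiable. [folklore] -/
theorem differentiable_stuartW : Differentiable ℝ stuartW := fun x => (hasFDerivAt_stuartW x).differentiableAt

/-- `W` is continuous. [folklore] -/
theorem continuous_stuartW : Continuous stuartW := differentiable_stuartW.continuous

/-! ## The Stuart column -/

/-- The Stuart column `V(x) = (cos x₂ (e^{x₀} − e^{−x₀})/W, −cos x₂ sin x₁/W, −3 sin x₂/W²)`. [folklore] -/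
def stuartField (x : E3) : E3 :=
  (Real.cos (x 2) * (Real.exp (x 0) - Real.exp (-(x 0))) * (stuartW x)⁻¹) • (𝐞 0) +
    (-(Real.cos (x 2) * Real.sin (x 1) * (stuartW x)⁻¹)) • (𝐞 1) +
    (-(3 * Real.sin (x 2) * ((stuartW x)⁻¹ * (stuartW x)⁻¹))) • (𝐞 2)

/-- The components of `V(x)`. [folklore] -/
theorem stuartField_apply_zero (x : E3) :
    stuartField x 0 = Real.cos (x 2) * (Real.exp (x 0) - Real.exp (-(x 0))) * (stuartW x)⁻¹ := by
  simp [stuartField]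

/-- The second component of `V(x)`. [folklore] -/
theorem stuartField_apply_one (x : E3) :
    stuartField x 1 = -(Real.cos (x 2) * Real.sin (x 1) * (stuartW x)⁻¹) := by
  simp [stuartField]

/-- The third component of `V(x)`. [folklore] -/
theorem stuartField_apply_two (x : E3) :
    stuartField x 2 = -(3 * Real.sin (x 2) * ((stuartW x)⁻¹ * (stuartW x)⁻¹)) := by
  simp [stuartField]

/-- **The derivative of the Stuart column in closed form**: with `P = e^{x₀} − e^{−x₀}`, `Q = e^{x₀} + e^{−x₀}`,
`r = W⁻¹`, the Jacobian `(∂ⱼVᵢ)` is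
`((cos x₂ (Q r − P² r²), cos x₂ P sin x₁ r², −sin x₂ P r), (cos x₂ sin x₁ P r², −cos x₂ (cos x₁ r + sin² x₁ r²),
sin x₂ sin x₁ r), (6 sin x₂ P r³, −6 sin x₂ sin x₁ r³, −3 cos x₂ r²))`. [folklore] -/
def stuartDeriv (x : E3) : E3 →L[ℝ] E3 :=
  ((Real.cos (x 2) * ((Real.exp (x 0) + Real.exp (-(x 0))) * (stuartW x)⁻¹ -
          (Real.exp (x 0) - Real.exp (-(x 0))) ^ 2 * (stuartW x)⁻¹ ^ 2)) • (π 0) +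
        (Real.cos (x 2) * (Real.exp (x 0) - Real.exp (-(x 0))) * Real.sin (x 1) * (stuartW x)⁻¹ ^ 2) • (π 1) +
        (-(Real.sin (x 2) * (Real.exp (x 0) - Real.exp (-(x 0))) * (stuartW x)⁻¹)) • (π 2)).smulRight (𝐞 0) +
    ((Real.cos (x 2) * Real.sin (x 1) * (Real.exp (x 0) - Real.exp (-(x 0))) * (stuartW x)⁻¹ ^ 2) • (π 0) +
        (-(Real.cos (x 2) * (Real.cos (x 1) * (stuartW x)⁻¹ + Real.sin (x 1) ^ 2 * (stuartW x)⁻¹ ^ 2))) • (π 1) +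
        (Real.sin (x 2) * Real.sin (x 1) * (stuartW x)⁻¹) • (π 2)).smulRight (𝐞 1) +
    ((6 * Real.sin (x 2) * (Real.exp (x 0) - Real.exp (-(x 0))) * (stuartW x)⁻¹ ^ 3) • (π 0) +
        (-(6 * Real.sin (x 2) * Real.sin (x 1) * (stuartW x)⁻¹ ^ 3)) • (π 1) +
        (-(3 * Real.cos (x 2) * (stuartW x)⁻¹ ^ 2)) • (π 2)).smulRight (𝐞 2)

/-- The components of `DV(x) w`. [folklore] -/
theorem stuartDeriv_apply_zero (x w : E3) : stuartDeriv x w 0 =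
    Real.cos (x 2) * ((Real.exp (x 0) + Real.exp (-(x 0))) * (stuartW x)⁻¹ -
          (Real.exp (x 0) - Real.exp (-(x 0))) ^ 2 * (stuartW x)⁻¹ ^ 2) * w 0 +
      Real.cos (x 2) * (Real.exp (x 0) - Real.exp (-(x 0))) * Real.sin (x 1) * (stuartW x)⁻¹ ^ 2 * w 1 +
      -(Real.sin (x 2) * (Real.exp (x 0) - Real.exp (-(x 0))) * (stuartW x)⁻¹) * w 2 := by
  simp [stuartDeriv]

/-- The second component of `DV(x) w`. [folklore] -/
theorem stuartDeriv_apply_one (x w : E3) : stuartDeriv x w 1 =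
    Real.cos (x 2) * Real.sin (x 1) * (Real.exp (x 0) - Real.exp (-(x 0))) * (stuartW x)⁻¹ ^ 2 * w 0 +
      -(Real.cos (x 2) * (Real.cos (x 1) * (stuartW x)⁻¹ + Real.sin (x 1) ^ 2 * (stuartW x)⁻¹ ^ 2)) * w 1 +
      Real.sin (x 2) * Real.sin (x 1) * (stuartW x)⁻¹ * w 2 := by
  simp [stuartDeriv]

/-- The third component of `DV(x) w`. [folklore] -/
theorem stuartDeriv_apply_two (x w : E3) : stuartDeriv x w 2 =
    6 * Real.sin (x 2) * (Real.exp (x 0) - Real.exp (-(x 0))) * (stuartW x)⁻¹ ^ 3 * w 0 +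
      -(6 * Real.sin (x 2) * Real.sin (x 1) * (stuartW x)⁻¹ ^ 3) * w 1 +
      -(3 * Real.cos (x 2) * (stuartW x)⁻¹ ^ 2) * w 2 := by
  simp [stuartDeriv]

/-- **`V` is differentiable with derivative `stuartDeriv`** (chain and product rules, then the algebra
`d(W⁻¹) = −W⁻² dW`). [folklore] -/
theorem hasFDerivAt_stuartField (x : E3) : HasFDerivAt stuartField (stuartDeriv x) x := by
  have h0 : HasFDerivAt (fun y : E3 => y 0) (π 0) x := (π 0).hasFDerivAt
  have h1 : HasFDerivAt (fun y : E3 => y 1) (π 1) x := (π 1).hasFDerivAt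
  have h2 : HasFDerivAt (fun y : E3 => y 2) (π 2) x := (π 2).hasFDerivAt
  have hE := (Real.hasDerivAt_exp (x 0)).comp_hasFDerivAt x h0
  have hE' := (Real.hasDerivAt_exp (-(x 0))).comp_hasFDerivAt x h0.neg
  have hs1 := (Real.hasDerivAt_sin (x 1)).comp_hasFDerivAt x h1
  have hs2 := (Real.hasDerivAt_sin (x 2)).comp_hasFDerivAt x h2
  have hc2 := (Real.hasDerivAt_cos (x 2)).comp_hasFDerivAt x h2
  have hr : HasFDerivAt (fun y : E3 => (stuartW y)⁻¹)
      ((-(stuartW x ^ 2)⁻¹) • (Real.exp (x 0) • (π 0) + Real.exp (-(x 0)) • (-(π 0)) +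
        (-(Real.sin (x 1))) • (π 1))) x :=
    (hasDerivAt_inv (stuartW_ne_zero x)).comp_hasFDerivAt x (hasFDerivAt_stuartW x)
  have hV0 := ((hc2.mul (hE.sub hE')).mul hr).smul_const (𝐞 0)
  have hV1 := ((hc2.mul hs1).mul hr).neg.smul_const (𝐞 1)
  have hV2 := (((hs2.const_mul (3 : ℝ)).mul (hr.mul hr)).neg).smul_const (𝐞 2)
  have H : HasFDerivAt stuartField _ x := (hV0.add hV1).add hV2
  refine H.congr_fderiv ?_
  have hW := stuartW_ne_zero x
  ext w i
  fin_cases i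
  · simp [stuartDeriv]
    field_simp
    ring
  · simp [stuartDeriv]
    field_simp
    ring
  · simp [stuartDeriv]
    field_simp
    ring

/-- `DV = stuartDeriv`. [folklore] -/
theorem fderiv_stuartField (x : E3) : fderiv ℝ stuartField x = stuartDeriv x :=
  (hasFDerivAt_stuartField x).fderiv

/-- `V` is differentiable. [folklore] -/
theorem differentiable_stuartField : Differentiable ℝ stuartField :=
  fun x => (hasFDerivAt_stuartField x).differentiableAt

/-- `V` is continuous. [folklore] -/
theorem continuous_stuartField : Continuous stuartField := differentiable_stuartField.continuous

/-- `‖V(x)‖ ≤ 6` (`|V₀| ≤ (e^{x₀} + e^{−x₀})/W ≤ (W + 1)/W ≤ 2`, `|V₁| ≤ 1/W ≤ 1`, `|V₂| ≤ 3/W² ≤ 3`). [folklore] -/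
theorem norm_stuartField_le (x : E3) : ‖stuartField x‖ ≤ 6 := by
  have hW1 := one_le_stuartW x
  have hWpos := stuartW_pos x
  have hr : (stuartW x)⁻¹ ≤ 1 := inv_le_one_of_one_le₀ hW1
  have hr0 : 0 ≤ (stuartW x)⁻¹ := inv_nonneg.2 hWpos.le
  have hc2 := Real.abs_cos_le_one (x 2)
  have hs2 := Real.abs_sin_le_one (x 2)
  have hs1 := Real.abs_sin_le_one (x 1)
  have e0 : ‖(𝐞 0)‖ = 1 := by simp
  have e1 : ‖(𝐞 1)‖ = 1 := by simp
  have e2 : ‖(𝐞 2)‖ = 1 := by simp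
  -- `|P| ≤ Q = W − cos x₁ ≤ W + 1 ≤ 2W`
  have hP : |Real.exp (x 0) - Real.exp (-(x 0))| * (stuartW x)⁻¹ ≤ 2 := by
    have hPQ : |Real.exp (x 0) - Real.exp (-(x 0))| ≤ Real.exp (x 0) + Real.exp (-(x 0)) := by
      rw [abs_le]; constructor <;> nlinarith [Real.exp_pos (x 0), Real.exp_pos (-(x 0))]
    have hQ : Real.exp (x 0) + Real.exp (-(x 0)) ≤ 2 * stuartW x := by
      unfold stuartW
      nlinarith [Real.neg_one_le_cos (x 1), Real.add_one_le_exp (x 0), Real.add_one_le_exp (-(x 0))]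
    rw [← div_eq_mul_inv, div_le_iff₀ hWpos]
    linarith
  unfold stuartField
  refine (norm_add_le _ _).trans ?_
  refine (add_le_add (norm_add_le _ _) le_rfl).trans ?_
  simp only [norm_smul, e0, e1, e2, mul_one, Real.norm_eq_abs, abs_neg, abs_mul, abs_inv, abs_of_pos hWpos,
    abs_of_pos (show (0 : ℝ) < 3 by norm_num)]
  have h1 : |Real.cos (x 2)| * |Real.exp (x 0) - Real.exp (-(x 0))| * (stuartW x)⁻¹ ≤ 2 := by
    rw [mul_assoc]
    nlinarith [abs_nonneg (Real.cos (x 2)), abs_nonneg (Real.exp (x 0) - Real.exp (-(x 0))),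
      mul_nonneg (abs_nonneg (Real.exp (x 0) - Real.exp (-(x 0)))) hr0]
  have h2 : |Real.cos (x 2)| * |Real.sin (x 1)| * (stuartW x)⁻¹ ≤ 1 := by
    have : |Real.cos (x 2)| * |Real.sin (x 1)| ≤ 1 := by
      nlinarith [abs_nonneg (Real.cos (x 2)), abs_nonneg (Real.sin (x 1))]
    nlinarith [mul_nonneg (abs_nonneg (Real.cos (x 2))) (abs_nonneg (Real.sin (x 1)))]
  have h3 : 3 * |Real.sin (x 2)| * ((stuartW x)⁻¹ * (stuartW x)⁻¹) ≤ 3 := by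
    have : (stuartW x)⁻¹ * (stuartW x)⁻¹ ≤ 1 := by nlinarith
    nlinarith [abs_nonneg (Real.sin (x 2)), mul_nonneg hr0 hr0]
  linarith

/-! ## The Type-I profile -/

/-- The Type-I profile `v(t, x) = (−t)^{-1/2} V(x)` (the witness). [folklore] -/
def stuartProfile (t : ℝ) (x : E3) : E3 := cellAmp t • stuartField x

/-- `Dv(t) = (−t)^{-1/2} DV`. [folklore] -/
theorem fderiv_stuartProfile (t : ℝ) (x : E3) : fderiv ℝ (stuartProfile t) x = cellAmp t • stuartDeriv x :=
  ((hasFDerivAt_stuartField x).const_smul (cellAmp t)).fderiv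

/-- `Dv(t)(x) w` in coordinates. [folklore] -/
theorem fderiv_stuartProfile_apply (t : ℝ) (x w : E3) (i : Fin 3) :
    fderiv ℝ (stuartProfile t) x w i = cellAmp t * stuartDeriv x w i := by
  rw [fderiv_stuartProfile]; rfl

/-- `v(t)` is differentiable. [folklore] -/
theorem differentiable_stuartProfile (t : ℝ) : Differentiable ℝ (stuartProfile t) :=
  fun x => ((hasFDerivAt_stuartField x).const_smul (cellAmp t)).differentiableAt

/-- `∂₂ v₀ = −(−t)^{-1/2} sin x₂ P/W`. [folklore] -/
theorem fderiv_stuartProfile_e2_apply_zero (t : ℝ) (x : E3) :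
    fderiv ℝ (stuartProfile t) x (𝐞 2) 0 =
      cellAmp t * (-(Real.sin (x 2) * (Real.exp (x 0) - Real.exp (-(x 0))) * (stuartW x)⁻¹)) := by
  rw [fderiv_stuartProfile_apply, stuartDeriv_apply_zero]; simp

/-- `∂₂ v₁ = (−t)^{-1/2} sin x₂ sin x₁/W`. [folklore] -/
theorem fderiv_stuartProfile_e2_apply_one (t : ℝ) (x : E3) :
    fderiv ℝ (stuartProfile t) x (𝐞 2) 1 = cellAmp t * (Real.sin (x 2) * Real.sin (x 1) * (stuartW x)⁻¹) := by
  rw [fderiv_stuartProfile_apply, stuartDeriv_apply_one]; simp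

/-- `∂₀ v₂ = 6 (−t)^{-1/2} sin x₂ P/W³`. [folklore] -/
theorem fderiv_stuartProfile_e0_apply_two (t : ℝ) (x : E3) :
    fderiv ℝ (stuartProfile t) x (𝐞 0) 2 =
      cellAmp t * (6 * Real.sin (x 2) * (Real.exp (x 0) - Real.exp (-(x 0))) * (stuartW x)⁻¹ ^ 3) := by
  rw [fderiv_stuartProfile_apply, stuartDeriv_apply_two]; simp

/-- `∂₁ v₂ = −6 (−t)^{-1/2} sin x₂ sin x₁/W³`. [folklore] -/
theorem fderiv_stuartProfile_e1_apply_two (t : ℝ) (x : E3) :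
    fderiv ℝ (stuartProfile t) x (𝐞 1) 2 =
      cellAmp t * (-(6 * Real.sin (x 2) * Real.sin (x 1) * (stuartW x)⁻¹ ^ 3)) := by
  rw [fderiv_stuartProfile_apply, stuartDeriv_apply_two]; simp

/-- **Thick proportional shear** `6 ∂₂ v_b = −W² ∂_b v₂` (`b = 0, 1`): the Clebsch slope `Λ = −W²/6` varies across
the vortex lines. [folklore] -/
theorem thickShear_stuartProfile (t : ℝ) (x : E3) (b : Fin 3) (hb : b ≠ 2) :
    6 * fderiv ℝ (stuartProfile t) x (𝐞 2) b = -(stuartW x ^ 2) * fderiv ℝ (stuartProfile t) x (𝐞 b) 2 := by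
  have hW := stuartW_ne_zero x
  fin_cases b
  · simp only [Fin.zero_eta, Fin.isValue]
    rw [fderiv_stuartProfile_e2_apply_zero, fderiv_stuartProfile_e0_apply_two]
    field_simp
  · simp only [Fin.mk_one, Fin.isValue]
    rw [fderiv_stuartProfile_e2_apply_one, fderiv_stuartProfile_e1_apply_two]
    field_simp
  · exact absurd rfl hb

/-! ## The vorticity -/

/-- The vorticity pattern `Ω(x) = −sin x₂ (W⁻¹ + 6 W⁻³) (sin x₁, e^{x₀} − e^{−x₀}, 0)` (`curl V = Ω`). [folklore] -/
def stuartVort (x : E3) : E3 :=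
  (-(Real.sin (x 2) * Real.sin (x 1) * ((stuartW x)⁻¹ + 6 * (stuartW x)⁻¹ ^ 3))) • (𝐞 0) +
    (-(Real.sin (x 2) * (Real.exp (x 0) - Real.exp (-(x 0))) * ((stuartW x)⁻¹ + 6 * (stuartW x)⁻¹ ^ 3))) • (𝐞 1)

/-- `curl v(t) = (−t)^{-1/2} Ω` (the vertical component `∂₀V₁ − ∂₁V₀ = cos x₂ sin x₁ P r² − cos x₂ P sin x₁ r²`
vanishes). [folklore] -/
theorem curl_stuartProfile (t : ℝ) (x : E3) : curl (stuartProfile t) x = cellAmp t • stuartVort x := by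
  ext i
  fin_cases i <;>
    simp [curl, stuartVort, fderiv_stuartProfile, stuartDeriv_apply_zero, stuartDeriv_apply_one,
      stuartDeriv_apply_two] <;> ring

/-- The vorticity slice as a function. [folklore] -/
theorem curl_stuartProfile_eq (t : ℝ) : curl (stuartProfile t) = fun x => cellAmp t • stuartVort x :=
  funext (curl_stuartProfile t)

/-- The components of `curl v(t)(x)`. [folklore] -/
theorem curl_stuartProfile_apply_zero (t : ℝ) (x : E3) :
    curl (stuartProfile t) x 0 =
      cellAmp t * (-(Real.sin (x 2) * Real.sin (x 1) * ((stuartW x)⁻¹ + 6 * (stuartW x)⁻¹ ^ 3))) := by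
  rw [curl_stuartProfile]; simp [stuartVort]

/-- The second component of `curl v(t)(x)`. [folklore] -/
theorem curl_stuartProfile_apply_one (t : ℝ) (x : E3) :
    curl (stuartProfile t) x 1 =
      cellAmp t * (-(Real.sin (x 2) * (Real.exp (x 0) - Real.exp (-(x 0))) *
        ((stuartW x)⁻¹ + 6 * (stuartW x)⁻¹ ^ 3))) := by
  rw [curl_stuartProfile]; simp [stuartVort]

/-- The third component of `curl v(t)(x)` vanishes (poloidal along `e₂`). [folklore] -/
theorem curl_stuartProfile_apply_two (t : ℝ) (x : E3) : curl (stuartProfile t) x 2 = 0 := by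
  rw [curl_stuartProfile]; simp [stuartVort]

/-! ## The class hypotheses (R), (C), (D), (P) and the frozen constraint -/

/-- `‖v(t)(x)‖ ≤ 6 (−t)^{-1/2}`. [folklore] -/
theorem norm_stuartProfile_le (t : ℝ) (x : E3) : ‖stuartProfile t x‖ ≤ cellAmp t * 6 := by
  unfold stuartProfile
  rw [norm_smul, Real.norm_of_nonneg (cellAmp_nonneg t)]
  exact mul_le_mul_of_nonneg_left (norm_stuartField_le x) (cellAmp_nonneg t)

/-- (R) the Type-I time rate with constant `6`. [folklore] -/
theorem hasTypeITimeDecay_stuartProfile : HasTypeITimeDecay 6 stuartProfile := by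
  intro t _ x
  have h := norm_stuartProfile_le t x
  rw [cellAmp] at h
  rw [div_eq_inv_mul]
  exact h

/-- (C) continuity on the open backward slab. [folklore] -/
theorem continuousOn_stuartProfile :
    ContinuousOn (Function.uncurry stuartProfile) (Set.Iio (0 : ℝ) ×ˢ Set.univ) := by
  have hamp : ContinuousOn (fun z : ℝ × E3 => cellAmp z.1) (Set.Iio (0 : ℝ) ×ˢ Set.univ) := by
    refine ContinuousOn.inv₀ ?_ fun z hz => (Real.sqrt_pos.2 (neg_pos.2 (show z.1 < 0 from hz.1))).ne'
    exact ((Real.continuous_sqrt.comp continuous_neg).comp continuous_fst).continuousOn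
  exact hamp.smul (continuous_stuartField.comp continuous_snd).continuousOn

/-- (D) divergence-free slices — this is the Liouville identity `W ΔW − |∇W|² = (e^{x₀} + e^{−x₀})² − (e^{x₀} − e^{−x₀})²
− cos² x₁ − sin² x₁ = 3`. [folklore] -/
theorem isDivFree_stuartProfile (t : ℝ) : VectorCalculus.IsDivFree (stuartProfile t) := by
  intro y
  rw [divergence_eq_sum_inner_fderiv (EuclideanSpace.basisFun (Fin 3) ℝ), Fin.sum_univ_three]
  simp only [EuclideanSpace.basisFun_apply, EuclideanSpace.inner_single_left, map_one, one_mul,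
    fderiv_stuartProfile_apply, stuartDeriv_apply_zero, stuartDeriv_apply_one, stuartDeriv_apply_two,
    PiLp.single_apply]
  simp
  have hWr : stuartW y * (stuartW y)⁻¹ = 1 := mul_inv_cancel₀ (stuartW_ne_zero y)
  have hE := exp_mul_exp_neg (y 0)
  have hsc := Real.sin_sq_add_cos_sq (y 1)
  have hWdef : stuartW y = Real.exp (y 0) + Real.exp (-(y 0)) + Real.cos (y 1) := rfl
  linear_combination (cellAmp t * Real.cos (y 2)) *
    (-((Real.exp (y 0) + Real.exp (-(y 0)) - Real.cos (y 1)) * (stuartW y)⁻¹) * hWr +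
      ((Real.exp (y 0) + Real.exp (-(y 0)) - Real.cos (y 1)) * (stuartW y)⁻¹ ^ 2) * hWdef +
      4 * (stuartW y)⁻¹ ^ 2 * hE - (stuartW y)⁻¹ ^ 2 * hsc)

/-- (P) poloidal along `e₂` everywhere on every slice. [folklore] -/
theorem poloidal_stuartProfile (s : ℝ) (y : E3) : ⟪curl (stuartProfile s) y, (𝐞 2)⟫_ℝ = 0 := by
  rw [EuclideanSpace.inner_single_right, curl_stuartProfile_apply_two]
  simp

/-- (F) the frozen constraint `⟪Dv(s)(y) curl v(s)(y), e₂⟫ = 0`: `v₂` is a first integral of the vortex lines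
(`ω·∇V₂ ∝ sin x₁ · P − P · sin x₁ = 0`). [folklore] -/
theorem frozen_stuartProfile (s : ℝ) (y : E3) :
    ⟪fderiv ℝ (stuartProfile s) y (curl (stuartProfile s) y), (𝐞 2)⟫_ℝ = 0 := by
  rw [EuclideanSpace.inner_single_right, fderiv_stuartProfile_apply, stuartDeriv_apply_two,
    curl_stuartProfile_apply_zero, curl_stuartProfile_apply_one, curl_stuartProfile_apply_two, RCLike.conj_to_real]
  ring

end Summit.NavierStokesRegularity.NavierStokesRegularity.Theorems.PoloidalWindowRigidity.Negative

end
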